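import Summits.HodgeConjecture.CorCM.MumfordTateRankSemisimpleTimesCMCenter
import Summits.HodgeConjecture.CorCM.MumfordTateRankSixCMRank
import HarnessLib

/-!
# The semisimple-rank-one part of EVERY rung `t = dim MT(H¹X)` as an IFF with the CM part as the only datum:
# `t(X) = t ∧ dim [Lie Hg, Lie Hg](H¹X) = 3 ⟺ X ∼ B^{m+1} × Z`, `B` a non-CM curve / QM surface, `Z` of CM type with `t(Z) = t − 3`

COR-CM (cell `pub-hodgecm2`, seat `b27` gen 43, count-neutral Mumford–Tate-rank ladder; theorems only, no definition, no
named fact; UNCONDITIONAL — nothing here uses or asserts HC_CM).  Capstone of the rank-one rungs: gen 37/38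
(`CorCM/MumfordTateRankSixIsogeny`, `…SixCMRank`) split every `X` with `dim [Lie Hg, Lie Hg](H¹X) = 3` as `X ∼ B^{m+1} × Z`
with `Z` of CM type and `t(Z) + 3 = t(X)` (for the `Z` PRODUCED by the splitting); gen 43 (`CorCM/MumfordTateRankSemisimpleTimesCM`,
`…Center`) proved the converses `t(X) = t(Z) + 3` and `dim [Lie Hg, Lie Hg](H¹X) = 3` for EVERY such product.  Together:

* **`mtRank_eq_and_finrank_derived_eq_three_iff`** — for `0 < dim X` and `5 ≤ t`:
  `t(X) = t ∧ dim [Lie Hg, Lie Hg](H¹X) = 3` IFF `X ∼ B^{m+1} × Z` with `B` simple, not of CM type, `0 < dim B ≤ 2`,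
  `dim End⁰B = (dim B)²`, `Z(End⁰B) = ℚ`, and `Z` of CM type with `0 < dim Z` and `t(Z) = t − 3` (`Hg(X) = SL₂ · Hg(Z)`,
  `dim Hg(Z) = t − 4`).  So the rank-one part of each rung is EXACTLY the CM rung three steps below: `t = 5 ↔ t(Z) = 2`
  (powers of one CM elliptic curve), `t = 6 ↔ t(Z) = 3`, `t = 7 ↔ t(Z) = 4` (`CorCM/MumfordTateRankFourCM`: incl. MZ's
  degenerate simple CM fourfolds), `t = 8 ↔ t(Z) = 5`, …
(The bottom case `t = 4`, `Z = 0`, is gen 33's `CorCM/MumfordTateRankFour`: `X ∼ B^{m+1}`.)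

## References
* [MoonenZarhin1999LowDim] B. Moonen, Yu. Zarhin, Math. Ann. 315 (1999), §2 (2.1)–(2.5), §3 Thm. (3.2)(2)
  [corpus: paper:arxiv-math_9901113 pp. 4–6].
* [Deligne1982HodgeCycles] P. Deligne, LNM 900 (1982), I §3.1, Prop. 3.4, Prop. 3.6.
* [MumfordAV1970] D. Mumford, *Abelian Varieties* (1970), §19 Thm. 1, Cor. 1–2.
-/

noncomputable section

open CategoryTheory CategoryTheory.Limits Module

namespace Summit.HodgeConjecture.CorCM

open Literature.AlgebraicGeometry.Motives
open Literature.AlgebraicGeometry.Motives.AbelianVariety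
open Literature.AlgebraicGeometry.Motives.HodgeStructure
open Literature.AlgebraicGeometry.HodgeTheory
open Literature.AlgebraicGeometry.Milne1999 (IsOfCMType)

variable [HodgeTensorFacts.{0, 0}] {X : AbelianVariety ℂ} {n : ℕ}

/-- **The rank-one part of the rung `t` (`5 ≤ t`) is the CM rung `t − 3`**: for `0 < dim X`,
`t(X) = t ∧ dim [Lie Hg, Lie Hg](H¹X) = 3` iff `X ∼ B^{m+1} × Z` with `B` a simple non-CM curve or QM surface
(`0 < dim B ≤ 2`, `dim_ℚ End⁰B = (dim B)²`, `Z(End⁰B) = ℚ`) and `Z` of CM type of positive dimension with `t(Z) = t − 3`.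
`⟹`: the splitting of `CorCM/MumfordTateRankSixCMRank` (`Z ≠ 0` since `t ≠ 4`); `⟸`: `t(X) = t(Z) + 3`
(`mtRank_hodge_one_eq_add_three_of_isIsogenous_powSucc_prod`) and `dim [Lie Hg, Lie Hg](H¹X) = 3`
(`finrank_hodgeLie_derived_hodge_one_eq_three_of_isIsogenous_powSucc_prod`). [cite: MoonenZarhin1999LowDim, §2 (2.1)–(2.5)]
[cite: MoonenZarhin1999LowDim, §3 Thm. (3.2)(2)] [cite: MumfordAV1970, §19 Thm. 1, Cor. 1–2 (pp. 173–174)] -/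
theorem mtRank_eq_and_finrank_derived_eq_three_iff (hX : IsSmoothProjective n X.X) (h0 : 0 < X.dim) {t : ℕ} (ht : 5 ≤ t) :
    haveI := BettiUniverse.finite hX 1
    ((BettiUniverse.hodge exists_isReal_hodgeModel_holds hX 1).mtRank = t ∧
      Module.finrank ℚ ↥(Submodule.span ℚ {C | ∃ A ∈ (BettiUniverse.hodge exists_isReal_hodgeModel_holds hX 1).hodgeLie,
        ∃ D ∈ (BettiUniverse.hodge exists_isReal_hodgeModel_holds hX 1).hodgeLie, A * D - D * A = C}) = 3) ↔
      ∃ (B Z : AbelianVariety ℂ) (m : ℕ), B.IsSimple ∧ 0 < B.dim ∧ B.dim ≤ 2 ∧ ¬ IsOfCMType B ∧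
        Module.finrank ℚ B.endAlgebra = B.dim ^ 2 ∧ Module.finrank ℚ (Subalgebra.center ℚ B.endAlgebra) = 1 ∧
        IsOfCMType Z ∧ 0 < Z.dim ∧
        (haveI := BettiUniverse.finite (AbelianVariety.isSmoothProjective_holds (A := Z)) 1;
          (BettiUniverse.hodge exists_isReal_hodgeModel_holds
            (AbelianVariety.isSmoothProjective_holds (A := Z)) 1).mtRank + 3 = t) ∧
        IsIsogenous X ((B.powSucc m).prod Z) := by
  haveI := BettiUniverse.finite hX 1
  constructor
  · rintro ⟨hXt, h3⟩
    obtain ⟨B, Z, m, hBs, hB0, hB2, hBcm, hfinB, hZB, hcm, hXBZ, -, hZ0iff, -, -, hZt⟩ :=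
      exists_isIsogenous_powSucc_prod_finrank_hodgeLie_of_finrank_derived_eq_three hX h0 h3
    have hZ0 : 0 < Z.dim := by
      rcases Nat.eq_zero_or_pos Z.dim with hz | hz
      · have h4 := hZ0iff.1 hz
        omega
      · exact hz
    exact ⟨B, Z, m, hBs, hB0, hB2, hBcm, hfinB, hZB, hcm, hZ0, by have := hZt hZ0; omega, hXBZ⟩
  · rintro ⟨B, Z, m, hBs, hB0, hB2, hBcm, hfinB, hZB, hcm, hZ0, hZt, hXBZ⟩
    refine ⟨?_, finrank_hodgeLie_derived_hodge_one_eq_three_of_isIsogenous_powSucc_prod hX hBs hB0 hB2 hBcm hfinB hZB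
      hcm hXBZ⟩
    rw [mtRank_hodge_one_eq_add_three_of_isIsogenous_powSucc_prod hX hBs hB0 hB2 hBcm hfinB hZB hcm hZ0 hXBZ]
    exact hZt

end Summit.HodgeConjecture.CorCM

end
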